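import Literature.AnabelianGeometry.EtaleTheta.Discharge.Sec1Thm16iiiOfInversionClauses
import Literature.AnabelianGeometry.EtaleTheta.Discharge.Sec1InvNegatesFdd1Quot
import Literature.AnabelianGeometry.EtaleTheta.Discharge.Sec1DeltaThetaEndoComm
import Literature.AnabelianGeometry.EtaleTheta.Discharge.Sec2DeltaThetaTorsionFree
import Literature.AnabelianGeometry.EtaleTheta.Discharge.Sec1DtpYddThetaCompact
import HarnessLib

/-!
# [EtTh] Thm. 1.6 (iii) with the Prop. 1.5 (ii)(iii) rows taken FROM THE ROOT CLAUSES (proof-only consolidation)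

Mochizuki, *The étale theta function and its Frobenioid-theoretic manifestations*, Publ. RIMS **45** (2009), Thm. 1.6
(iii) pp. 24–25, Prop. 1.5 (ii)(iii) p. 23 [cite: MochizukiEtTh2009, Thm 1.6 (iii) p.25]. abc-iut cell, layer L2, seat
abc-iut-L2-t1 (§1 ROOT owner). PROOF-ONLY (0 `def`). Consolidates this seat's chain over abc-iut-L6-d5's K3 capstone:
`thm16iii_of_inversionClauses` (p440684) took, on the β side, the binders `hneg : InvNegatesFdd1Quot` («ι = −1 on
F̈¹/F̈²»), `hquot : Prop15iiQuot` («F̈¹/F̈² = Ẑ·log(Ü)») and `h2` («Δ_Θ has no 2-torsion»); since then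
`hneg ⟸ hquot + IsInversionAut` (p440905 `IsInversionAut.invNegatesFdd1Quot`), `hquot ⟸ clause (a) + topology +
origin` (p443206/EndoComm `prop15iiQuot_of_stdLog_of_origin`), and `h2 ⟸ IsEtThOrigin` (abc-iut's
`deltaTheta_eq_one_of_sq_eq_one`, Sec2DeltaThetaTorsionFree). Hence:

* `ThetaSetting.IsEtThOrigin.deltaTheta_sq_eq_one`, `.exists_deltaTheta_zpow_ne_one` — the two torsion inputs of
  `Prop15iiQuot.mem_Fdd2_of_sq_mem` / `.eq_zero_of_logUdd_zpow_mem` under the guard; `hL_of_origin` (GAP G-L2t1-1's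
  binder from the root predicate at an origin setting);
* `Thm16Sub.thm16iii_of_rootClauses` — [EtTh] Thm. 1.6 (iii) whose Prop. 1.5 (ii)(iii) inputs on the β side are
  EXACTLY: `HasThetaTopology` (census S1-1), `IsEtThOrigin` (F-2498), clause (a) «log(Ü) restricts to the standard
  isomorphism» (compactness of `(Δ^tp_Ÿ)^Θ` being a THEOREM of `HasThetaTopology`, `Sec1DtpYddThetaCompact`) (`IsStdLog λ`, `res logUdd = [λ]`), the ι-clause `InvClauses` (both sides) for
  COMPATIBLE inversion automorphisms (`IsInversionAut`, «γ ∘ ια = ιβ ∘ γ»), besides the K3 rows kept as in the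
  capstone (Thm 1.6 (i)(ii) data, `Prop15ii`/`Prop15iii` facts, valuation data, the two cusp evaluations).
HONEST FRAMING: [EtTh] is refereed; nothing here bears on [IUTchIII] Cor. 3.12; typed ≠ proved; no side taken.
-/

noncomputable section

namespace Literature.AnabelianGeometry.EtaleTheta

open Literature.AnabelianGeometry.SemiGraphs

namespace ThetaSetting

variable {p : ℕ} [Fact p.Prime] {D : ThetaSetting p}

/-- Under the guard, `Δ_Θ` (as a subtype) has no `2`-torsion (abc-iut's `deltaTheta_eq_one_of_sq_eq_one`).
[cite: MochizukiEtTh2009, §1 p.12] -/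
theorem IsEtThOrigin.deltaTheta_sq_eq_one (hO : D.IsEtThOrigin) (t : D.DeltaTheta) (ht : t * t = 1) : t = 1 := by
  apply Subtype.ext
  refine D.deltaTheta_eq_one_of_sq_eq_one hO t.2 ?_
  rw [sq, ← Subgroup.coe_mul, ht, OneMemClass.coe_one]

/-- Under the guard, no nonzero integer kills `Δ_Θ` (`Δ_Θ ≠ 1` is a clause of `IsEtThOrigin`; torsion-freeness).
[cite: MochizukiEtTh2009, §1 p.12] -/
theorem IsEtThOrigin.exists_deltaTheta_zpow_ne_one (hO : D.IsEtThOrigin) (n : ℤ) (hn : n ≠ 0) :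
    ∃ t : D.DeltaTheta, t ^ n ≠ 1 := by
  obtain ⟨t, ht, ht1⟩ : ∃ t ∈ D.DeltaTheta, t ≠ 1 := by
    by_contra h
    push Not at h
    exact hO.deltaTheta_ne_bot ((Subgroup.eq_bot_iff_forall _).mpr h)
  refine ⟨⟨t, ht⟩, fun htn => ht1 ?_⟩
  have key : t ^ n.natAbs = 1 := by
    have h' : ((⟨t, ht⟩ : D.DeltaTheta) : D.GtpTheta) ^ n = 1 := by
      rw [← Subgroup.coe_zpow, htn, OneMemClass.coe_one]
    rcases Int.natAbs_eq n with hc | hc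
    · rw [hc, zpow_natCast] at h'
      simpa using h'
    · rw [hc, zpow_neg, zpow_natCast, inv_eq_one] at h'
      simpa using h'
  exact D.deltaTheta_torsionfree hO ht (Int.natAbs_ne_zero.mpr hn) key

/-- **`hL` (GAP G-L2t1-1) at an origin setting from the root predicate**: `Prop15iiQuot E hC` + `IsEtThOrigin` ⇒
`log(Ü)^n ∈ F̈² → n = 0`. [cite: MochizukiEtTh2009, Prop 1.5 (ii) p.23] -/
theorem Prop15iiQuot.hL_of_origin {E : D.KummerData} {hC : D.Compat} (h : Prop15iiQuot E hC) (hO : D.IsEtThOrigin)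
    {n : ℤ} (hn : E.logUdd ^ n ∈ (Fdd2 : Subgroup (D.H1Theta (D.GtpYdd.map D.toTheta)))) : n = 0 :=
  h.eq_zero_of_logUdd_zpow_mem (fun m hm => hO.exists_deltaTheta_zpow_ne_one m hm) hn

/-- **`htf` (K3 capstone) at an origin setting from the root predicate**: `Prop15iiQuot E hC` + `IsEtThOrigin` ⇒
`d ∈ F̈¹ → d·d ∈ F̈² → d ∈ F̈²`. [cite: MochizukiEtTh2009, Prop 1.5 (ii) p.23] -/
theorem Prop15iiQuot.htf_of_origin {E : D.KummerData} {hC : D.Compat} (h : Prop15iiQuot E hC) (hO : D.IsEtThOrigin)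
    {d : D.H1Theta (D.GtpYdd.map D.toTheta)} (hd : d ∈ Fdd1 hC)
    (hsq : d * d ∈ (Fdd2 : Subgroup (D.H1Theta (D.GtpYdd.map D.toTheta)))) :
    d ∈ (Fdd2 : Subgroup (D.H1Theta (D.GtpYdd.map D.toTheta))) :=
  h.mem_Fdd2_of_sq_mem hO.deltaTheta_sq_eq_one hd hsq

/-- **«F̈¹/F̈² = Ẑ·log(Ü)» from clause (a) alone**, all topological side conditions from `HasThetaTopology` (compactness of
`(Δ^tp_Ÿ)^Θ` included, `Sec1DtpYddThetaCompact`) and the guard. [cite: MochizukiEtTh2009, Prop 1.5 (ii) p.23] -/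
theorem prop15iiQuot_of_stdLog_of_hasThetaTopology (hC : D.Compat) (hT : D.HasThetaTopology) (hO : D.IsEtThOrigin)
    {E : D.KummerData} {lam : ↥((D.DtpYddN 1).map D.toTheta) →ₜ* D.DeltaTheta} (hstd : IsStdLog lam)
    (hres : ContH1.res (MonoidHom.id D.GtpTheta) D.DeltaTheta D.map_toTheta_DtpYddN_one_le E.logUdd =
      homClass dtpYddTheta_le_deltaTheta_map lam) :
    Prop15iiQuot E hC :=
  prop15iiQuot_of_stdLog_of_origin hC hT hO hT.isCompact_dtpYddTheta hstd hres

/-- **Which part of Prop. 1.5 (iii)'s clause (2) is geometric.** From the root predicates alone — `IsInversionAut ι`,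
«F̈¹/F̈² = Ẑ·log(Ü)» (`Prop15iiQuot`) and «F̈² = Kummer classes» (`Prop15ii.Fdd2_eq`) — the Θ-level action of ANY
inversion automorphism (no normalisation) satisfies `T(log Ü) = log(Ü)⁻¹ · κ(c)` for some `c ∈ (K̈^×)^∧`; print's
clause (2) («… + log(O^×_K̈)», `InvClauses.logUdd_inv`) is the sharpening `c = u ∈ O^×_K̈`, which is the genuinely
geometric content (the value `ι^*(Ü)·Ü = ±1` for the inversion fixing the component labelled `0`).
[cite: MochizukiEtTh2009, Prop 1.5 (iii) p.23] -/
theorem IsInversionAut.exists_apply_logUdd_eq {ι : D.PiTemp ≃ₜ* D.PiTemp} (hι : D.IsInversionAut ι)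
    (cι : ThetaCompanion ι) {hC : D.Compat} {E : D.KummerData} (hquot : Prop15iiQuot E hC)
    (h15ii : Prop15ii E hC)
    (T : D.H1Theta (D.GtpYdd.map D.toTheta) ≃* D.H1Theta (D.GtpYdd.map D.toTheta))
    (hT : ∀ z, D.inflTheta D.GtpYdd (T z) = transport cι hι.thm16i (D.inflTheta D.GtpYdd z)) :
    ∃ c : E.KddHat, T E.logUdd = E.logUdd⁻¹ * E.kumYdd c := by
  have h := hι.invNegatesFdd1Quot cι hquot T hT E.logUdd hquot.logUdd_mem_Fdd1
  rw [h15ii.Fdd2_eq] at h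
  obtain ⟨c, hc⟩ := h
  refine ⟨c, ?_⟩
  rw [hc, mul_comm (T E.logUdd) E.logUdd, ← mul_assoc, inv_mul_cancel, one_mul]

end ThetaSetting

namespace Thm16Sub

open Literature.AnabelianGeometry.SemiGraphs

variable {p : ℕ} [Fact p.Prime] {Dα Dβ : ThetaSetting p} {γ : Dα.PiTemp ≃ₜ* Dβ.PiTemp}

/-- **[EtTh] Theorem 1.6 (iii), Prop. 1.5 (ii)(iii) rows FROM THE ROOT CLAUSES**: as `thm16iii_of_inversionClauses`,
with `hneg`, `hquot`, `h2` replaced by the β-side root inputs `HasThetaTopology`, `IsEtThOrigin` and clause (a) of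
Prop. 1.5 (ii) («log(Ü) restricts on (Δ^tp_Ÿ)^Θ to the standard isomorphism»).
[cite: MochizukiEtTh2009, Thm 1.6 (iii) p.25] -/
theorem thm16iii_of_rootClauses (h : ThetaSetting.Thm16i γ) (c : ThetaSetting.ThetaCompanion γ)
    (hΔ : Dα.DeltaTemp.map γ.toMulEquiv.toMonoidHom = Dβ.DeltaTemp)
    (Eα : Dα.EtaleThetaData) (Eβ : Dβ.EtaleThetaData) (hCα : Dα.Compat) (hCβ : Dβ.Compat)
    (hSβ : Dβ.Sec2Hyps) (h15iiα : ThetaSetting.Prop15ii Eα.toKummerData hCα)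
    (h15ii : ThetaSetting.Prop15ii Eβ.toKummerData hCβ)
    (h15α : ThetaSetting.Prop15iii Eα hCα) (h15β : ThetaSetting.Prop15iii Eβ hCβ)
    {σ : Dβ.PiTemp} (hσ : σ ∈ Dβ.GtpYdd)
    -- row L11 (b)(c): valuation data with the genuine kernel and the [AbsAnab] 1.2.1 clauses for the induced δ
    (Vα : ThetaSetting.ValuationHatData Dα Eα.toKummerData)
    (Vβ : ThetaSetting.ValuationHatData Dβ Eβ.toKummerData)
    (hVα : Vα.unitsHat = Dα.unitsOKdd.map Eα.toKddHat) (hVβ : Vβ.unitsHat = Dβ.unitsOKdd.map Eβ.toKddHat)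
    (hV : ∀ δ : Eα.KddHat ≃* Eβ.KddHat,
      (∀ a, ThetaSetting.transport c h (Dα.inflTheta Dα.GtpYdd (Eα.kumYdd a)) =
        Dβ.inflTheta Dβ.GtpYdd (Eβ.kumYdd (δ a))) → DeltaPreservesUnitsAndOne δ Vα Vβ)
    -- the β-side ROOT inputs: topology (census S1-1), the guard, Prop 1.5 (ii) clause (a)
    (hTβ : Dβ.HasThetaTopology) (hOβ : Dβ.IsEtThOrigin)
    {lamβ : ↥((Dβ.DtpYddN 1).map Dβ.toTheta) →ₜ* Dβ.DeltaTheta} (hstdβ : ThetaSetting.IsStdLog lamβ)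
    (hresβ : ContH1.res (MonoidHom.id Dβ.GtpTheta) Dβ.DeltaTheta Dβ.map_toTheta_DtpYddN_one_le Eβ.logUdd =
      ThetaSetting.homClass ThetaSetting.dtpYddTheta_le_deltaTheta_map lamβ)
    -- Prop 1.5 (iii) ι-clauses for COMPATIBLE inversion automorphisms (root predicates)
    {ια : Dα.PiTemp ≃ₜ* Dα.PiTemp} (hια : Dα.IsInversionAut ια) (cα : ThetaSetting.ThetaCompanion ια)
    (hInvα : ThetaSetting.InvClauses Eα hια cα)
    {ιβ : Dβ.PiTemp ≃ₜ* Dβ.PiTemp} (hιβ : Dβ.IsInversionAut ιβ) (cβ : ThetaSetting.ThetaCompanion ιβ)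
    (hInvβ : ThetaSetting.InvClauses Eβ hιβ cβ)
    (hcompat : ∀ g, γ.toMulEquiv (ια.toMulEquiv g) = ιβ.toMulEquiv (γ.toMulEquiv g))
    -- row L15: the two cusp evaluations
    (y : ThetaSetting.CuspidalPointDd Eβ.toKummerData) {u₁ u₂ v₁ v₂ : (↥Dβ.Kdd)ˣ}
    (hu₁ : u₁ ∈ Dβ.unitsOKdd) (hu₂ : u₂ ∈ Dβ.unitsOKdd)
    (hv : ‖((v₁ : Dβ.Kdd) : PadicAlgCl p)‖ = ‖((v₂ : Dβ.Kdd) : PadicAlgCl p)‖)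
    (h₁ : haveI := hCβ.GtpYdd_normal
      y.evalAt (ContH1.res Dβ.toTheta Dβ.DeltaTheta (y.sec_le.trans y.Dpt_le)
        (ContH1.conj Dβ.toTheta Dβ.DeltaTheta σ Eβ.etaDd)) = Eβ.toKddHat (u₁ * v₁))
    (h₂ : y.evalAt (ContH1.res Dβ.toTheta Dβ.DeltaTheta (y.sec_le.trans y.Dpt_le)
        (ThetaSetting.transport c h Eα.etaDd)) = Eβ.toKddHat (u₂ * v₂)) :
    ThetaSetting.Thm16iii γ h c Eα Eβ hCβ := by
  have hquot : ThetaSetting.Prop15iiQuot Eβ.toKummerData hCβ :=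
    ThetaSetting.prop15iiQuot_of_stdLog_of_origin hCβ hTβ hOβ hTβ.isCompact_dtpYddTheta hstdβ hresβ
  exact thm16iii_of_inversionClauses h c hΔ Eα Eβ hCα hCβ hSβ h15iiα h15ii h15α h15β hσ Vα Vβ hVα hVβ hV
    hια cα hInvα hιβ cβ hInvβ (hιβ.invNegatesFdd1Quot cβ hquot) hcompat hquot hOβ.deltaTheta_sq_eq_one
    y hu₁ hu₂ hv h₁ h₂

end Thm16Sub

end Literature.AnabelianGeometry.EtaleTheta

end
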